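import Summits.QuantumFields.BalabanUV.T4Continuum.Spine.NE1p.DressedRebornMuPartTorus
import Summits.QuantumFields.BalabanUV.T4Continuum.Spine.NE1p.DressedRebornMuResponseWitness
import Summits.QuantumFields.BalabanUV.T4Continuum.Spine.NE1p.DressedRebornMuResponseBipencilWitness

/-!
# T⁴ programme, spine estimate NE1′ (node O3b/H2) — WITNESS «S64's TORUS FACES FIRE»: the four located ENDs of S64
# `DressedRebornMuPartTorus` (S56 §2∕§3 + S61 §2∕§3 at pv22's `tgeometry 4 N`) APPLIED ONCE EACH BY NAME on the decided data of record —
# W84's exp-linear bi-pencil `actB` (§1∕§2) and W86's Gaussian-core bi-pencil `actM` (§3∕§4) — with the located smallness letters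
# `hrate_torus_num` ∕ `hsmall_torus_num` ∕ `hsmall_mu_num`; every CLOSED form of W84 ∕ W92 ∕ W86 ∕ W101 (`4K₀‖μ‖σ∕(μ₁ε)`,
# `4K₀σ∕(ε(μ₁ − μ₀))`, `(16∕3)K₀‖μ‖‖v‖`, `(16∕3)K₀‖v‖∕(1 − 2μ₀)`) re-derived by `field_simp; ring` ALONE — the hand re-location of
# pv22's numerals (`torus_consts` ∕ `K₀_four` rewrites inside each witness) is no longer needed: S64 did it once for the column

Cell `pub-balaban`, sub-cell `t4`, row NE1′ formalisation crew (`t4/formal/NE1p/LEAVES.md` row W114 ∕ DAG N29zzzzzzg, BOOKED typer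
R-T157, read X264 ok; INTENT `HOME/CLAIMS.log`
2026-08-21), unit `b2b-balaban-t4-ne1p-formalise-leaf-03` (LEAF PROVER 03, gen 15; S64's holder lineage).  ADDITIVE — imports S64
`Spine/NE1p/DressedRebornMuPartTorus` (p245129; → S61 → S56) + W92 `Spine/NE1p/DressedRebornMuResponseWitness` (leaf-06 g13, p243723;
→ W84 `DressedRebornMuPartWitness`, W31, W24) + W101 `Spine/NE1p/DressedRebornMuResponseBipencilWitness` (leaf-06 g14, p244815; → W86
`DressedRebornMuPartBipencilWitness`, W51, W35, W33) ONLY — all LANDED and BUILT; THEOREMS ONLY (0 def, 0 `def … : Prop`, 0 cite,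
0 sorry); nothing of S64 ∕ S61 ∕ S56 ∕ W84 ∕ W86 ∕ W92 ∕ W101 ∕ W31 ∕ W35 ∕ W33 ∕ W24 is restated — their plumbing lemmas are used BY NAME.

WHY.  S64 (this lineage, landed 02:27Z under RULE (f.4)) delivers the re-born μ-part and its response at `tsys 4 N` ∕ `tgeometry 4 N`
with pv22's numerals LOCATED and no `Geometry` binder; it had no applier.  The four decided witnesses of the column (W84 ∕ W86 size,
W92 ∕ W101 response) each fire the `Geometry`-form END and then re-locate the numerals by hand.  Here the torus faces are fired DIRECTLY:
* §0 `hsmall_torus_num` ∕ `hsmall_mu_num` — the smallness letters of W24's `A = (e·K₀(64,8)·9·64)⁻¹` and W35's `Acst` in S64's located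
  shape `A·e^{5·0+1}·K₀(64,8)·9·64 ≤ 1` (pure arithmetic; `Acst` unfolds to W24's `A`);
* §1 **`rebornEnd_expLinear_fires`** = S64 §0 EXACTLY ONCE on W84's datum (W84's argument list VERBATIM, `hrate_torus_num` ∕
  `hsmall_torus_num` for the two clause letters, `R := 2·(64·log 162) + 2`), `rebornEnd_expLinear_fires_closed` (`4K₀‖μ‖σ∕(μ₁ε)` —
  W84's value) and an `example` showing W84's `Geometry`-display statement IS this one (the two `locE` displays denote one term);
* §2 **`responseEnd_expLinear_fires`** = S64 §2 EXACTLY ONCE (W92's list VERBATIM + window), `…_closed` = W92's value in W92's display;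
* §3 **`rebornEnd_cores_fires`** = S64 §1 EXACTLY ONCE on W86's datum (W86's list VERBATIM, `hsmall_mu_num`), `…_closed` = W86's value;
* §4 **`responseEnd_cores_fires`** = S64 §3 EXACTLY ONCE (W101's list VERBATIM + window), `…_closed` = W101's value; located `example`
  at the quarter window (`μ₀ = μ = ¼`, `r = 1`): `(4∕3)K₀‖v‖` and `(32∕3)K₀‖v‖`.

WHAT THIS SAYS AND DOES NOT SAY.  A consistency record of OUR bookkeeping: the torus column (S64) and the hand-relocated witnesses give
byte-comparable closed forms on the same data; nothing new is bounded.  The data are OUR decided toys (NE5's toy frame, W33's Gaussian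
cores, pv22's one-cube torus carrier); the closed constants are READINGS of the dressed (w5) constant and its response; (B1a) exercised on
toys, (w5)∕(w6) NOT discharged on Bałaban's densities.

HONEST FRAMING.  A DECIDED TOY ∕ by-name junctions ([folklore]; 0 sorry; 0 citations; no `def`); (B1b) ∕ (B3) ∕ (B5) NOT discharged
((B3) = G-ne9p2-5 UNPRINTED, here MET BY CHOICE on the toys); no numeral of [Balaban1988RGII] or any audited manuscript; 0 binders
instantiated on Bałaban's densities; no wall item; the NE1′ wall wording of record v1.8 (T4-DAG v48; v49–v51 carry it verbatim) — words,
not kind — does NOT move; R-t4r2-Q2 NOT met thereby; no internally-minted statement becomes a cited fact (ABSOLUTE RULE).  NE1′ ⇐ the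
named binders — NOT proved, NOT printed; spine PROVED 0∕9; count 9 unchanged.  Rung (B)+1 on ONE finite four-torus — NOT infinite
volume, NOT a mass gap, NOT OS on ℝ⁴, NOT Clay.
HONEST DEPENDENCY: continuum YM on T⁴ ⇐ BetaPertH ∧ nine spine estimates (0/9 proved); BetaPertH ⇐ (D1) ∧ (D4) ∧ CAP+tail; G-an2-4
gates asym, D1 and NE2/3/4.
-/

noncomputable section

namespace Summit.QuantumFields.BalabanUV.T4Continuum.NE1p.DressedRebornMuPartTorusWitness

open Metric Set Complex MeasureTheory
open scoped BigOperators
open Literature.MathematicalPhysics.QuantumFieldTheory.Balaban1983to89.T4InputCauchyRate (toyCarriers)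
open Literature.MathematicalPhysics.QuantumFieldTheory.Balaban1983to89.T4InputCauchyRateSpecies (ballClass toyCtr)
open Literature.MathematicalPhysics.QuantumFieldTheory.Balaban1983to89.B13Resummation (locE)
open Literature.MathematicalPhysics.QuantumFieldTheory.Balaban1983to89.B12TreeDecay (K₀ K₀_pos)
open Literature.MathematicalPhysics.QuantumFieldTheory.Balaban1983to89.TreeLengthTorus (TDom tsys torusTreeLen)
open Literature.MathematicalPhysics.QuantumFieldTheory.Balaban1983to89.TreeLengthTorusGeometry (TTouch tgeometry)
open Summit.QuantumFields.BalabanUV.T4Continuum.B13HistMeasurable (B13HistM)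
open Summit.QuantumFields.BalabanUV.T4Continuum.B13HistWitness (toyFrame)
open Summit.QuantumFields.BalabanUV.T4Continuum.NE1p.DressedSmallFieldTorusWitness (X₀ hrate_torus_num prefactor_pos)
open Summit.QuantumFields.BalabanUV.T4Continuum.NE1p.DressedSmallFieldOnCoresWitness (wTerm wMeas wPhi wLam termHistExpLinear_wTerm
  norm_wLam_le terms actW hact hR hK cW hL3)
open Summit.QuantumFields.BalabanUV.T4Continuum.NE1p.DressedSmallFieldCoresWitness (liveTable coreFam ctr0 hroom0 Acst Acst_pos termsW)
open Summit.QuantumFields.BalabanUV.T4Continuum.NE1p.DressedSmallFieldCoresMassWitness (cM actM)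
open Summit.QuantumFields.BalabanUV.T4Continuum.NE1p.DressedRebornMuPartWitness (actB mem_pencilDisc differentiableOn_bipencil)
open Summit.QuantumFields.BalabanUV.T4Continuum.NE1p.DressedRebornMuPartBipencilWitness (norm_quarter_liveTable_pos
  norm_quarter_liveTable_lt hH_bi hM3_bi hact_bi)
open Summit.QuantumFields.BalabanUV.T4Continuum.NE1p.DressedRebornMuPartTorus (rebornMuPart_locE_le_of_expLinear_torus
  rebornMuDeriv_locE_le_of_expLinear_torus rebornMuPart_locE_le_of_coresAt_bipencil_mass_torus
  rebornMuDeriv_locE_le_of_coresAt_bipencil_mass_torus)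

variable (N : ℕ) [NeZero N]

/-! ## §0 The two torus-numeral smallness letters of the data (W24's `hsmall_torus` and W35's `hsmall_mu` in S64's located shape) -/

/-- The smallness letter `A·e^{5·0+1}·K₀(64,8)·9·64 ≤ 1` for W24's `A = (e·K₀(64,8)·9·64)⁻¹`, in S64's located shape — an EQUALITY
(pure arithmetic on the located numerals; W24's `hsmall_torus` states it in the `Geometry` form). [folklore] -/
theorem hsmall_torus_num : (Real.exp 1 * K₀ 64 8 * 9 * 64)⁻¹ * Real.exp (5 * 0 + 1) * K₀ 64 8 * 9 * 64 ≤ 1 := by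
  rw [mul_zero, zero_add, show (Real.exp 1 * K₀ 64 8 * 9 * 64)⁻¹ * Real.exp 1 * K₀ 64 8 * 9 * 64 =
      (Real.exp 1 * K₀ 64 8 * 9 * 64)⁻¹ * (Real.exp 1 * K₀ 64 8 * 9 * 64) by ring, inv_mul_cancel₀ prefactor_pos.ne']

/-- The same letter for W35's letter-budget weight `Acst` (`= (e·K₀(64,8)·9·64)⁻¹` by definition; W35's `hsmall_mu` states it in the
`Geometry` form). [folklore] -/
theorem hsmall_mu_num : Acst * Real.exp (5 * 0 + 1) * K₀ 64 8 * 9 * 64 ≤ 1 := by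
  unfold Acst
  exact hsmall_torus_num

/-! ## §1 S64 §0 `rebornMuPart_locE_le_of_expLinear_torus` FIRES on W84's exp-linear bi-pencil datum `actB` -/

open Classical in
/-- **S64 §0 FIRES ON W84's DATUM** [decided toy]: W84's `rebornEnd_fires` argument list VERBATIM (W31's `termHistExpLinear_wTerm`, `hK` ∕
`hR` ∕ `hact` ∕ `hL3`, W84's `mem_pencilDisc` ∕ `differentiableOn_bipencil`), with `hrate_torus_num` ∕ `hsmall_torus_num` in place of the
`Geometry`-form letters; conclusion in S64's LOCATED currency — no `torus_consts` ∕ `K₀_four` rewrite needed afterwards. [folklore] -/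
theorem rebornEnd_expLinear_fires {a w₀ : ℂ} {μ₁ σ ε : ℝ} (hσ : 0 < σ) (hσε : σ < ε)
    (hw : (μ₁ * ‖a‖ + ε / σ) * ‖w₀‖ ≤ 2) (k : ℕ) (g : ℕ → ℝ) {μ : ℂ} (hμ : ‖μ‖ < μ₁) :
    ‖locE (Dom := (tsys 4 N).Dom) (TTouch (d := 4) (N := N)) (fun Z : (tsys 4 N).Dom => Z.1)
          (actB N (μ₁ * ‖a‖ + ε / σ) a w₀ (μ, 1)) (X₀ N).1 -
          locE (Dom := (tsys 4 N).Dom) (TTouch (d := 4) (N := N)) (fun Z : (tsys 4 N).Dom => Z.1)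
          (actB N (μ₁ * ‖a‖ + ε / σ) a w₀ (0, 1)) (X₀ N).1 -
        (locE (Dom := (tsys 4 N).Dom) (TTouch (d := 4) (N := N)) (fun Z : (tsys 4 N).Dom => Z.1)
          (actB N (μ₁ * ‖a‖ + ε / σ) a w₀ (μ, 0)) (X₀ N).1 -
          locE (Dom := (tsys 4 N).Dom) (TTouch (d := 4) (N := N)) (fun Z : (tsys 4 N).Dom => Z.1)
          (actB N (μ₁ * ‖a‖ + ε / σ) a w₀ (0, 0)) (X₀ N).1)‖ ≤
      2 * (2 * (Real.exp 1 * 9 * 64 * K₀ 64 8 ^ 2 * (Real.exp 1 * K₀ 64 8 * 9 * 64)⁻¹ *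
        Real.exp (-(0 * torusTreeLen (X₀ N).1))) / μ₁ * ‖μ‖) / ε * σ :=
  rebornMuPart_locE_le_of_expLinear_torus
    (termHistExpLinear_wTerm (cW (μ₁ * ‖a‖ + ε / σ) w₀) (ballClass toyCtr (fun _ => 1 / 8) fun _ => 2) Set.univ)
    (Set.mem_univ g) (U := ()) (o := 0) (hc := fun z : ℂ × ℂ => (z.1 * a + z.2) * w₀) (R₀ := (μ₁ * ‖a‖ + ε / σ) * ‖w₀‖) hσ hσε
    (differentiableOn_bipencil a w₀ _) (fun z hz => hK hw k g () (z.1 * a + z.2) (mem_pencilDisc hz))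
    (fun z hz => hR (μ₁ * ‖a‖ + ε / σ) w₀ (z.1 * a + z.2) (mem_pencilDisc hz))
    (emb := fun _ => k) (fun _ => rfl) (terms := terms N) (act := actB N (μ₁ * ‖a‖ + ε / σ) a w₀)
    (fun z _ Z => hact N (cW (μ₁ * ‖a‖ + ε / σ) w₀) w₀ k (z.1 * a + z.2) Z) (N' := fun _ _ => 1) (fun _ _ => zero_le_one)
    (fun _ i _ => ae_of_all _ fun x => norm_wLam_le k i 0 k x)
    (A := (Real.exp 1 * K₀ 64 8 * 9 * 64)⁻¹) (R := 2 * (64 * Real.log 162) + 2) (r₁ := 0) (X₀ N)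
    (inv_nonneg.2 prefactor_pos.le) le_rfl hrate_torus_num hsmall_torus_num
    (hL3 N (μ₁ * ‖a‖ + ε / σ) w₀ k _) (mem_ball_zero_iff.2 hμ)

open Classical in
/-- … CLOSED: `≤ 4·K₀(64,8)·‖μ‖·σ∕(μ₁·ε)` — W84's `rebornEnd_fires_closed` VALUE, reached with `field_simp; ring` ALONE (no located-numeral
rewrite: S64 did it once for all). [folklore] -/
theorem rebornEnd_expLinear_fires_closed {a w₀ : ℂ} {μ₁ σ ε : ℝ} (hσ : 0 < σ) (hσε : σ < ε)
    (hw : (μ₁ * ‖a‖ + ε / σ) * ‖w₀‖ ≤ 2) (k : ℕ) (g : ℕ → ℝ) {μ : ℂ} (hμ : ‖μ‖ < μ₁) :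
    ‖locE (Dom := (tsys 4 N).Dom) (TTouch (d := 4) (N := N)) (fun Z : (tsys 4 N).Dom => Z.1)
          (actB N (μ₁ * ‖a‖ + ε / σ) a w₀ (μ, 1)) (X₀ N).1 -
          locE (Dom := (tsys 4 N).Dom) (TTouch (d := 4) (N := N)) (fun Z : (tsys 4 N).Dom => Z.1)
          (actB N (μ₁ * ‖a‖ + ε / σ) a w₀ (0, 1)) (X₀ N).1 -
        (locE (Dom := (tsys 4 N).Dom) (TTouch (d := 4) (N := N)) (fun Z : (tsys 4 N).Dom => Z.1)
          (actB N (μ₁ * ‖a‖ + ε / σ) a w₀ (μ, 0)) (X₀ N).1 -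
          locE (Dom := (tsys 4 N).Dom) (TTouch (d := 4) (N := N)) (fun Z : (tsys 4 N).Dom => Z.1)
          (actB N (μ₁ * ‖a‖ + ε / σ) a w₀ (0, 0)) (X₀ N).1)‖ ≤
      4 * K₀ 64 8 * ‖μ‖ * σ / (μ₁ * ε) := by
  have hμ₁ : 0 < μ₁ := (norm_nonneg μ).trans_lt hμ
  have hε : 0 < ε := hσ.trans hσε
  refine (rebornEnd_expLinear_fires N hσ hσε hw k g hμ).trans (le_of_eq ?_)
  rw [zero_mul, neg_zero, Real.exp_zero, mul_one]
  have hK : K₀ (64 : ℝ) 8 ≠ 0 := (K₀_pos _ _).ne'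
  have he : Real.exp 1 ≠ 0 := (Real.exp_pos 1).ne'
  field_simp
  ring

open Classical in
/-- **THE TWO ROUTES AGREE** [decided]: W84's hand-relocated closed form IS the torus face's (the `Geometry`-form display `locE (tgeometry 4 N).ι
(tgeometry 4 N).cubes … ((tgeometry 4 N).cubes (X₀ N))` and S64's pinned display denote the same term). -/
example {a w₀ : ℂ} {μ₁ σ ε : ℝ} (hσ : 0 < σ) (hσε : σ < ε) (hw : (μ₁ * ‖a‖ + ε / σ) * ‖w₀‖ ≤ 2) (k : ℕ) (g : ℕ → ℝ) {μ : ℂ}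
    (hμ : ‖μ‖ < μ₁) :
    ‖locE (tgeometry 4 N).ι (tgeometry 4 N).cubes (actB N (μ₁ * ‖a‖ + ε / σ) a w₀ (μ, 1)) ((tgeometry 4 N).cubes (X₀ N)) -
          locE (tgeometry 4 N).ι (tgeometry 4 N).cubes (actB N (μ₁ * ‖a‖ + ε / σ) a w₀ (0, 1)) ((tgeometry 4 N).cubes (X₀ N)) -
        (locE (tgeometry 4 N).ι (tgeometry 4 N).cubes (actB N (μ₁ * ‖a‖ + ε / σ) a w₀ (μ, 0)) ((tgeometry 4 N).cubes (X₀ N)) -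
          locE (tgeometry 4 N).ι (tgeometry 4 N).cubes (actB N (μ₁ * ‖a‖ + ε / σ) a w₀ (0, 0)) ((tgeometry 4 N).cubes (X₀ N)))‖ ≤
      4 * K₀ 64 8 * ‖μ‖ * σ / (μ₁ * ε) :=
  rebornEnd_expLinear_fires_closed N hσ hσε hw k g hμ

/-! ## §2 S64 §2 `rebornMuDeriv_locE_le_of_expLinear_torus` FIRES on the same datum (W92's response face) -/

open Classical in
/-- **S64 §2 FIRES ON W84's DATUM ON THE WINDOW** [decided toy]: W92's `responseEnd_fires` argument list VERBATIM with the torus-numeral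
letters; conclusion in S64's located currency. [folklore] -/
theorem responseEnd_expLinear_fires {a w₀ : ℂ} {μ₁ μ₀ σ ε : ℝ} (hσ : 0 < σ) (hσε : σ < ε)
    (hw : (μ₁ * ‖a‖ + ε / σ) * ‖w₀‖ ≤ 2) (h01 : μ₀ < μ₁) (k : ℕ) (g : ℕ → ℝ) {μ : ℂ} (hμ : ‖μ‖ ≤ μ₀) :
    ‖deriv (fun m : ℂ =>
        locE (Dom := (tsys 4 N).Dom) (TTouch (d := 4) (N := N)) (fun Z : (tsys 4 N).Dom => Z.1)
            (actB N (μ₁ * ‖a‖ + ε / σ) a w₀ (m, 1)) (X₀ N).1 -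
          locE (Dom := (tsys 4 N).Dom) (TTouch (d := 4) (N := N)) (fun Z : (tsys 4 N).Dom => Z.1)
            (actB N (μ₁ * ‖a‖ + ε / σ) a w₀ (m, 0)) (X₀ N).1) μ‖ ≤
      2 * (2 * (Real.exp 1 * 9 * 64 * K₀ 64 8 ^ 2 * (Real.exp 1 * K₀ 64 8 * 9 * 64)⁻¹ *
        Real.exp (-(0 * torusTreeLen (X₀ N).1))) / ε * σ) / (μ₁ - μ₀) :=
  rebornMuDeriv_locE_le_of_expLinear_torus
    (termHistExpLinear_wTerm (cW (μ₁ * ‖a‖ + ε / σ) w₀) (ballClass toyCtr (fun _ => 1 / 8) fun _ => 2) Set.univ)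
    (Set.mem_univ g) (U := ()) (o := 0) (hc := fun z : ℂ × ℂ => (z.1 * a + z.2) * w₀) (R₀ := (μ₁ * ‖a‖ + ε / σ) * ‖w₀‖) hσ hσε
    (differentiableOn_bipencil a w₀ _) (fun z hz => hK hw k g () (z.1 * a + z.2) (mem_pencilDisc hz))
    (fun z hz => hR (μ₁ * ‖a‖ + ε / σ) w₀ (z.1 * a + z.2) (mem_pencilDisc hz))
    (emb := fun _ => k) (fun _ => rfl) (terms := terms N) (act := actB N (μ₁ * ‖a‖ + ε / σ) a w₀)
    (fun z _ Z => hact N (cW (μ₁ * ‖a‖ + ε / σ) w₀) w₀ k (z.1 * a + z.2) Z) (N' := fun _ _ => 1) (fun _ _ => zero_le_one)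
    (fun _ i _ => ae_of_all _ fun x => norm_wLam_le k i 0 k x)
    (A := (Real.exp 1 * K₀ 64 8 * 9 * 64)⁻¹) (R := 2 * (64 * Real.log 162) + 2) (r₁ := 0) (X₀ N)
    (inv_nonneg.2 prefactor_pos.le) le_rfl hrate_torus_num hsmall_torus_num
    (hL3 N (μ₁ * ‖a‖ + ε / σ) w₀ k _) h01 hμ

open Classical in
/-- … CLOSED: `≤ 4·K₀(64,8)·σ∕(ε·(μ₁ − μ₀))` — W92's `responseEnd_fires_closed` VALUE, by `field_simp; ring` alone (S64's pinned display;
W92's display follows as an `example`). [folklore] -/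
theorem responseEnd_expLinear_fires_closed {a w₀ : ℂ} {μ₁ μ₀ σ ε : ℝ} (hσ : 0 < σ) (hσε : σ < ε)
    (hw : (μ₁ * ‖a‖ + ε / σ) * ‖w₀‖ ≤ 2) (h01 : μ₀ < μ₁) (k : ℕ) (g : ℕ → ℝ) {μ : ℂ} (hμ : ‖μ‖ ≤ μ₀) :
    ‖deriv (fun m : ℂ =>
        locE (Dom := (tsys 4 N).Dom) (TTouch (d := 4) (N := N)) (fun Z : (tsys 4 N).Dom => Z.1) (actB N (μ₁ * ‖a‖ + ε / σ) a w₀ (m, 1)) (X₀ N).1 -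
          locE (Dom := (tsys 4 N).Dom) (TTouch (d := 4) (N := N)) (fun Z : (tsys 4 N).Dom => Z.1) (actB N (μ₁ * ‖a‖ + ε / σ) a w₀ (m, 0)) (X₀ N).1) μ‖ ≤
      4 * K₀ 64 8 * σ / (ε * (μ₁ - μ₀)) := by
  have hε : 0 < ε := hσ.trans hσε
  have hgap : 0 < μ₁ - μ₀ := sub_pos.2 h01
  refine (responseEnd_expLinear_fires N hσ hσε hw h01 k g hμ).trans (le_of_eq ?_)
  rw [zero_mul, neg_zero, Real.exp_zero, mul_one]
  have hK : K₀ (64 : ℝ) 8 ≠ 0 := (K₀_pos _ _).ne'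
  have he : Real.exp 1 ≠ 0 := (Real.exp_pos 1).ne'
  field_simp
  ring

open Classical in
/-- **THE TWO ROUTES AGREE** [decided]: W92's `responseEnd_fires_closed` statement, re-derived through S64 §2. -/
example {a w₀ : ℂ} {μ₁ μ₀ σ ε : ℝ} (hσ : 0 < σ) (hσε : σ < ε)
    (hw : (μ₁ * ‖a‖ + ε / σ) * ‖w₀‖ ≤ 2) (h01 : μ₀ < μ₁) (k : ℕ) (g : ℕ → ℝ) {μ : ℂ} (hμ : ‖μ‖ ≤ μ₀) :
    ‖deriv (fun m : ℂ =>
        locE (tgeometry 4 N).ι (tgeometry 4 N).cubes (actB N (μ₁ * ‖a‖ + ε / σ) a w₀ (m, 1)) ((tgeometry 4 N).cubes (X₀ N)) -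
          locE (tgeometry 4 N).ι (tgeometry 4 N).cubes (actB N (μ₁ * ‖a‖ + ε / σ) a w₀ (m, 0)) ((tgeometry 4 N).cubes (X₀ N))) μ‖ ≤
      4 * K₀ 64 8 * σ / (ε * (μ₁ - μ₀)) :=
  responseEnd_expLinear_fires_closed N hσ hσε hw h01 k g hμ

/-! ## §3 S64 §1 `rebornMuPart_locE_le_of_coresAt_bipencil_mass_torus` FIRES on W86's Gaussian-core bi-pencil datum `actM` -/

open Classical in
/-- **S64 §1 FIRES ON W86's DATUM** [decided toy]: W86's `rebornEnd_fires` argument list VERBATIM (W33's `coreFam` at W35's weight `cM`, NE5's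
toy letters `(mq, bq, N₀) = (1, 0, 1)` INLINE, W33's `hroom0` ∕ `ctr0`, W86's `hH_bi` ∕ `hM3_bi` ∕ `hact_bi` ∕ `norm_quarter_liveTable_pos` ∕
`_lt`), with `hrate_torus_num` ∕ `hsmall_mu_num` in place of the `Geometry`-form letters; conclusion in S64's located currency. [folklore] -/
theorem rebornEnd_cores_fires (r : ℝ) (hr : 0 ≤ r) (hr0 : 0 < r) (k : ℕ) {μ : ℂ} (hμ : μ ∈ ball (0 : ℂ) (1 / 2)) :
    ‖locE (Dom := (tsys 4 N).Dom) (TTouch (d := 4) (N := N)) (fun Z : (tsys 4 N).Dom => Z.1)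
          (actM N r hr k (μ + 1 * (1 / 4 : ℂ))) (X₀ N).1 -
          locE (Dom := (tsys 4 N).Dom) (TTouch (d := 4) (N := N)) (fun Z : (tsys 4 N).Dom => Z.1)
          (actM N r hr k (0 + 1 * (1 / 4 : ℂ))) (X₀ N).1 -
        (locE (Dom := (tsys 4 N).Dom) (TTouch (d := 4) (N := N)) (fun Z : (tsys 4 N).Dom => Z.1)
          (actM N r hr k (μ + 0 * (1 / 4 : ℂ))) (X₀ N).1 -
          locE (Dom := (tsys 4 N).Dom) (TTouch (d := 4) (N := N)) (fun Z : (tsys 4 N).Dom => Z.1)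
          (actM N r hr k (0 + 0 * (1 / 4 : ℂ))) (X₀ N).1)‖ ≤
      2 * (2 * (Real.exp 1 * 9 * 64 * K₀ 64 8 ^ 2 * Acst * Real.exp (-(0 * torusTreeLen (X₀ N).1))) / (1 / 2) * ‖μ‖) / (3 / 2) *
        ‖((1 / 4 : ℂ)) • (liveTable : B13HistM toyFrame)‖ :=
  rebornMuPart_locE_le_of_coresAt_bipencil_mass_torus (coreFam (cM r) r hr)
    (W := Set.univ) (ctr := ctr0) (ROp := fun _ => 1) (RHist := fun _ => 2) (R' := fun _ => 2)
    (mq := fun _ _ _ => 1) (bq := fun _ _ _ => 0) (N₀ := fun _ _ _ => 1)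
    hroom0 (fun _ _ _ _ _ _ _ => one_pos)
    (fun _ _ _ _ _ _ _ => ⟨fun _ _ => aestronglyMeasurable_const, fun _ => differentiableOn_const _, fun _ _ _ => by
      show ‖(1 : ℂ)‖ ≤ 1; rw [norm_one]⟩)
    (fun _ _ _ _ _ _ _ => ⟨fun _ _ => (Complex.measurable_ofReal.comp (measurable_snd.norm.pow_const 2)).aestronglyMeasurable,
      fun _ _ => differentiableOn_const _, fun _ _ _ v => by
        show 1 * ‖v‖ ^ 2 - 0 ≤ (((‖v‖ ^ 2 : ℝ) : ℂ)).re; rw [Complex.ofReal_re]; simp⟩)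
    (g := fun _ => 0) (Set.mem_univ _) (U := ()) (o := 0) (h₀ := 0) (u := liveTable) (v := (1 / 4 : ℂ) • liveTable) (μ₁ := 1 / 2)
    (ε := 3 / 2) (norm_quarter_liveTable_pos r hr0) (norm_quarter_liveTable_lt)
    (by show ‖(0 : ℂ) - 0‖ ≤ 1; simp) (hH_bi k)
    (emb := fun _ => k) (fun _ => rfl) (terms := termsW N) (act := fun z => actM N r hr k (z.1 + z.2 * (1 / 4 : ℂ))) (hact_bi N r hr k)
    (A := Acst) (R := 2 * (64 * Real.log 162) + 2) (r₁ := 0) (X₀ N)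
    Acst_pos.le le_rfl hrate_torus_num hsmall_mu_num (hM3_bi N r hr k _) hμ

open Classical in
/-- … CLOSED: `≤ (16∕3)·K₀(64,8)·‖μ‖·‖¼ • liveTable‖` — W86's `rebornEnd_fires_closed` VALUE (S64's pinned display; W86's display
follows as an `example`), by `unfold Acst; field_simp; ring` alone. [folklore] -/
theorem rebornEnd_cores_fires_closed (r : ℝ) (hr : 0 ≤ r) (hr0 : 0 < r) (k : ℕ) {μ : ℂ} (hμ : μ ∈ ball (0 : ℂ) (1 / 2)) :
    ‖locE (Dom := (tsys 4 N).Dom) (TTouch (d := 4) (N := N)) (fun Z : (tsys 4 N).Dom => Z.1) (actM N r hr k (μ + 1 * (1 / 4 : ℂ))) (X₀ N).1 -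
        locE (Dom := (tsys 4 N).Dom) (TTouch (d := 4) (N := N)) (fun Z : (tsys 4 N).Dom => Z.1) (actM N r hr k (0 + 1 * (1 / 4 : ℂ))) (X₀ N).1 -
        (locE (Dom := (tsys 4 N).Dom) (TTouch (d := 4) (N := N)) (fun Z : (tsys 4 N).Dom => Z.1) (actM N r hr k (μ + 0 * (1 / 4 : ℂ))) (X₀ N).1 -
          locE (Dom := (tsys 4 N).Dom) (TTouch (d := 4) (N := N)) (fun Z : (tsys 4 N).Dom => Z.1) (actM N r hr k (0 + 0 * (1 / 4 : ℂ))) (X₀ N).1)‖ ≤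
      16 / 3 * K₀ 64 8 * ‖μ‖ * ‖((1 / 4 : ℂ)) • (liveTable : B13HistM toyFrame)‖ := by
  refine (rebornEnd_cores_fires N r hr hr0 k hμ).trans (le_of_eq ?_)
  rw [zero_mul, neg_zero, Real.exp_zero, mul_one]
  unfold Acst
  have hK := K₀_pos (64 : ℝ) 8
  have he := Real.exp_pos 1
  field_simp
  ring

open Classical in
/-- **THE TWO ROUTES AGREE** [decided]: W86's `rebornEnd_fires_closed` statement, re-derived through S64 §1. -/
example (r : ℝ) (hr : 0 ≤ r) (hr0 : 0 < r) (k : ℕ) {μ : ℂ} (hμ : μ ∈ ball (0 : ℂ) (1 / 2)) :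
    ‖locE (tgeometry 4 N).ι (tgeometry 4 N).cubes (actM N r hr k (μ + 1 * (1 / 4 : ℂ))) ((tgeometry 4 N).cubes (X₀ N)) -
        locE (tgeometry 4 N).ι (tgeometry 4 N).cubes (actM N r hr k (0 + 1 * (1 / 4 : ℂ))) ((tgeometry 4 N).cubes (X₀ N)) -
        (locE (tgeometry 4 N).ι (tgeometry 4 N).cubes (actM N r hr k (μ + 0 * (1 / 4 : ℂ))) ((tgeometry 4 N).cubes (X₀ N)) -
          locE (tgeometry 4 N).ι (tgeometry 4 N).cubes (actM N r hr k (0 + 0 * (1 / 4 : ℂ))) ((tgeometry 4 N).cubes (X₀ N)))‖ ≤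
      16 / 3 * K₀ 64 8 * ‖μ‖ * ‖((1 / 4 : ℂ)) • (liveTable : B13HistM toyFrame)‖ :=
  rebornEnd_cores_fires_closed N r hr hr0 k hμ

/-! ## §4 S64 §3 `rebornMuDeriv_locE_le_of_coresAt_bipencil_mass_torus` FIRES on the same datum (W101's response face) -/

open Classical in
/-- **S64 §3 FIRES ON W86's DATUM ON THE WINDOW** [decided toy]: W101's `responseEnd_fires` argument list VERBATIM with the torus-numeral
letters. [folklore] -/
theorem responseEnd_cores_fires (r : ℝ) (hr : 0 ≤ r) (hr0 : 0 < r) (k : ℕ) {μ₀ : ℝ} (h01 : μ₀ < 1 / 2) {μ : ℂ} (hμ : ‖μ‖ ≤ μ₀) :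
    ‖deriv (fun m : ℂ =>
        locE (Dom := (tsys 4 N).Dom) (TTouch (d := 4) (N := N)) (fun Z : (tsys 4 N).Dom => Z.1)
            (actM N r hr k (m + 1 * (1 / 4 : ℂ))) (X₀ N).1 -
          locE (Dom := (tsys 4 N).Dom) (TTouch (d := 4) (N := N)) (fun Z : (tsys 4 N).Dom => Z.1)
            (actM N r hr k (m + 0 * (1 / 4 : ℂ))) (X₀ N).1) μ‖ ≤
      2 * (2 * (Real.exp 1 * 9 * 64 * K₀ 64 8 ^ 2 * Acst * Real.exp (-(0 * torusTreeLen (X₀ N).1))) / (3 / 2) *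
        ‖((1 / 4 : ℂ)) • (liveTable : B13HistM toyFrame)‖) / (1 / 2 - μ₀) :=
  rebornMuDeriv_locE_le_of_coresAt_bipencil_mass_torus (coreFam (cM r) r hr)
    (W := Set.univ) (ctr := ctr0) (ROp := fun _ => 1) (RHist := fun _ => 2) (R' := fun _ => 2)
    (mq := fun _ _ _ => 1) (bq := fun _ _ _ => 0) (N₀ := fun _ _ _ => 1)
    hroom0 (fun _ _ _ _ _ _ _ => one_pos)
    (fun _ _ _ _ _ _ _ => ⟨fun _ _ => aestronglyMeasurable_const, fun _ => differentiableOn_const _, fun _ _ _ => by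
      show ‖(1 : ℂ)‖ ≤ 1; rw [norm_one]⟩)
    (fun _ _ _ _ _ _ _ => ⟨fun _ _ => (Complex.measurable_ofReal.comp (measurable_snd.norm.pow_const 2)).aestronglyMeasurable,
      fun _ _ => differentiableOn_const _, fun _ _ _ v => by
        show 1 * ‖v‖ ^ 2 - 0 ≤ (((‖v‖ ^ 2 : ℝ) : ℂ)).re; rw [Complex.ofReal_re]; simp⟩)
    (g := fun _ => 0) (Set.mem_univ _) (U := ()) (o := 0) (h₀ := 0) (u := liveTable) (v := (1 / 4 : ℂ) • liveTable) (μ₁ := 1 / 2)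
    (ε := 3 / 2) (norm_quarter_liveTable_pos r hr0) (norm_quarter_liveTable_lt)
    (by show ‖(0 : ℂ) - 0‖ ≤ 1; simp) (hH_bi k)
    (emb := fun _ => k) (fun _ => rfl) (terms := termsW N) (act := fun z => actM N r hr k (z.1 + z.2 * (1 / 4 : ℂ))) (hact_bi N r hr k)
    (A := Acst) (R := 2 * (64 * Real.log 162) + 2) (r₁ := 0) (X₀ N)
    Acst_pos.le le_rfl hrate_torus_num hsmall_mu_num (hM3_bi N r hr k _) h01 hμ

open Classical in
/-- … CLOSED: `≤ (16∕3)·K₀(64,8)·‖¼ • liveTable‖∕(1 − 2μ₀)` — W101's `responseEnd_fires_closed` VALUE (S64's pinned display; W101's display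
follows as an `example`), by `field_simp; ring` alone. [folklore] -/
theorem responseEnd_cores_fires_closed (r : ℝ) (hr : 0 ≤ r) (hr0 : 0 < r) (k : ℕ) {μ₀ : ℝ} (h01 : μ₀ < 1 / 2) {μ : ℂ}
    (hμ : ‖μ‖ ≤ μ₀) :
    ‖deriv (fun m : ℂ =>
        locE (Dom := (tsys 4 N).Dom) (TTouch (d := 4) (N := N)) (fun Z : (tsys 4 N).Dom => Z.1) (actM N r hr k (m + 1 * (1 / 4 : ℂ))) (X₀ N).1 -
          locE (Dom := (tsys 4 N).Dom) (TTouch (d := 4) (N := N)) (fun Z : (tsys 4 N).Dom => Z.1) (actM N r hr k (m + 0 * (1 / 4 : ℂ))) (X₀ N).1) μ‖ ≤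
      16 / 3 * K₀ 64 8 * ‖((1 / 4 : ℂ)) • (liveTable : B13HistM toyFrame)‖ / (1 - 2 * μ₀) := by
  refine (responseEnd_cores_fires N r hr hr0 k h01 hμ).trans (le_of_eq ?_)
  rw [zero_mul, neg_zero, Real.exp_zero, mul_one]
  unfold Acst
  have hK := K₀_pos (64 : ℝ) 8
  have he := Real.exp_pos 1
  have h1 : (1 : ℝ) / 2 - μ₀ ≠ 0 := by intro h; linarith
  have h2 : (1 : ℝ) - 2 * μ₀ ≠ 0 := by intro h; linarith
  field_simp
  ring

open Classical in
/-- **THE TWO ROUTES AGREE** [decided]: W101's `responseEnd_fires_closed` statement, re-derived through S64 §3. -/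
example (r : ℝ) (hr : 0 ≤ r) (hr0 : 0 < r) (k : ℕ) {μ₀ : ℝ} (h01 : μ₀ < 1 / 2) {μ : ℂ}
    (hμ : ‖μ‖ ≤ μ₀) :
    ‖deriv (fun m : ℂ =>
        locE (tgeometry 4 N).ι (tgeometry 4 N).cubes (actM N r hr k (m + 1 * (1 / 4 : ℂ))) ((tgeometry 4 N).cubes (X₀ N)) -
          locE (tgeometry 4 N).ι (tgeometry 4 N).cubes (actM N r hr k (m + 0 * (1 / 4 : ℂ))) ((tgeometry 4 N).cubes (X₀ N))) μ‖ ≤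
      16 / 3 * K₀ 64 8 * ‖((1 / 4 : ℂ)) • (liveTable : B13HistM toyFrame)‖ / (1 - 2 * μ₀) :=
  responseEnd_cores_fires_closed N r hr hr0 k h01 hμ

open Classical in
/-- **LOCATED** [decided]: at the quarter window `μ₀ = μ = ¼`, weight `r = 1`: the four torus faces read `K₀·¼·σ∕…`-type numbers — here the
cores pair: `‖Δ‖ ≤ (4∕3)·K₀(64,8)·‖¼ • liveTable‖` and the response `≤ (32∕3)·K₀(64,8)·‖¼ • liveTable‖`. -/
example (k : ℕ) :
    ‖locE (tgeometry 4 N).ι (tgeometry 4 N).cubes (actM N 1 zero_le_one k ((1 / 4 : ℂ) + 1 * (1 / 4 : ℂ)))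
          ((tgeometry 4 N).cubes (X₀ N)) -
        locE (tgeometry 4 N).ι (tgeometry 4 N).cubes (actM N 1 zero_le_one k (0 + 1 * (1 / 4 : ℂ))) ((tgeometry 4 N).cubes (X₀ N)) -
        (locE (tgeometry 4 N).ι (tgeometry 4 N).cubes (actM N 1 zero_le_one k ((1 / 4 : ℂ) + 0 * (1 / 4 : ℂ)))
            ((tgeometry 4 N).cubes (X₀ N)) -
          locE (tgeometry 4 N).ι (tgeometry 4 N).cubes (actM N 1 zero_le_one k (0 + 0 * (1 / 4 : ℂ))) ((tgeometry 4 N).cubes (X₀ N)))‖ ≤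
      4 / 3 * K₀ 64 8 * ‖((1 / 4 : ℂ)) • (liveTable : B13HistM toyFrame)‖ ∧
    ‖deriv (fun m : ℂ =>
        locE (tgeometry 4 N).ι (tgeometry 4 N).cubes (actM N 1 zero_le_one k (m + 1 * (1 / 4 : ℂ))) ((tgeometry 4 N).cubes (X₀ N)) -
          locE (tgeometry 4 N).ι (tgeometry 4 N).cubes (actM N 1 zero_le_one k (m + 0 * (1 / 4 : ℂ))) ((tgeometry 4 N).cubes (X₀ N)))
        ((1 / 4 : ℂ))‖ ≤ 32 / 3 * K₀ 64 8 * ‖((1 / 4 : ℂ)) • (liveTable : B13HistM toyFrame)‖ := by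
  constructor
  · have h := rebornEnd_cores_fires_closed N 1 zero_le_one one_pos k (μ := (1 / 4 : ℂ)) (mem_ball_zero_iff.2 (by norm_num))
    have hq : ‖(1 / 4 : ℂ)‖ = 1 / 4 := by norm_num
    rw [hq] at h
    refine h.trans (le_of_eq ?_)
    ring
  · have h := responseEnd_cores_fires_closed N 1 zero_le_one one_pos k (μ₀ := 1 / 4) (by norm_num) (μ := (1 / 4 : ℂ)) (by norm_num)
    refine h.trans (le_of_eq ?_)
    ring

end Summit.QuantumFields.BalabanUV.T4Continuum.NE1p.DressedRebornMuPartTorusWitness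

end
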